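import Mathlib
import Summits.Ventures.PercRepro2.Defs
import Summits.Ventures.PercRepro2.Independence
import Summits.Ventures.PercRepro2.Harris
import Summits.Ventures.PercRepro2.Graph
import Summits.Ventures.PercRepro2.Exploration
import Summits.Ventures.PercRepro2.Events
import Summits.Ventures.PercRepro2.Induced
import Summits.Ventures.PercRepro2.BoxUnionDefs
import Summits.Ventures.PercRepro2.BoxUnion
import Summits.Ventures.PercRepro2.BoxUnionPair
import Summits.Ventures.PercRepro2.PairTP2
import Summits.Ventures.PercRepro2.PairTP2Main
import Summits.Ventures.PercRepro2.SeparatedDefs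
import Summits.Ventures.PercRepro2.SeparatedPair
import Summits.Ventures.PercRepro2.PairTP2BroomLemmas
import Summits.Ventures.PercRepro2.PairTP2Broom
import Summits.Ventures.PercRepro2.PairTP2BroomGrid

/-!
# (PAIR-TP2), the (⟹) direction — part 4: the four masses of a broom
(blind cell PercRepro2, mine-1 g39; proofs/MINE1-PAIRTP2.md §2′ without walks)

At the weights `wt a b d` the background of the broom is forced (`prob_inter_back`: edges of
weight `0` / `1` are closed / open almost surely), so each grid event reduces to one local
configuration and `M(S,T) = a(1−b)d`, `M(N,N) = (1−a)(1−d)` (the interface edge is free),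
`M(N,T) = (1−a)(1−b)d`, `M(S,N) = a(1−b)(1−d)`. The minor
`M(S,T)M(N,N) − M(N,T)M(S,N) = abd(1−a)(1−b)(1−d)` is positive for `a, b, d ∈ (0, 1)`: the
two-vertex status law of a broom is NOT log-supermodular on the (Z)-lattice (`Broom.not_lsm`).
-/

namespace Summit.Ventures.PercRepro2

namespace PairTP2Broom

open Finset
open scoped Classical

variable {V : Type*} {E : Type*} {ends : E → Sym2 V}

variable [DecidableEq E] {s t u v : V}

namespace Broom

section FinE

variable [Fintype E]

/-- The background cylinder: the configurations agreeing with `ω₁` off the three critical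
edges. -/
def back (B : Broom ends s t u v) : Set (Config E) :=
  cylinder ((Finset.univ : Finset E) \ {B.fs, B.g, B.ft}) B.ω₁

/-- Membership in the background cylinder is agreement. -/
lemma mem_back (B : Broom ends s t u v) {ω : Config E} : ω ∈ B.back ↔ B.Agrees ω := by
  simp only [back, mem_cylinder, Finset.mem_sdiff, Finset.mem_univ, true_and, Finset.mem_insert,
    Finset.mem_singleton, not_or]
  constructor
  · intro h e h1 h2 h3
    exact h e ⟨h1, h2, h3⟩
  · rintro h e ⟨h1, h2, h3⟩
    exact h e h1 h2 h3

/-- Edges of weight `0` or `1` are forced: intersecting with the cylinder they prescribe costs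
nothing. -/
lemma prob_inter_cylinder_of_forced (p : E → ℝ) (σ : Config E) (T : Finset E)
    (hT : ∀ e ∈ T, p e = if σ e = true then 1 else 0) (A : Set (Config E)) :
    prob p (A ∩ cylinder T σ) = prob p A := by
  induction T using Finset.induction_on generalizing A with
  | empty =>
    have : cylinder (∅ : Finset E) σ = Set.univ := by
      ext ω
      simp [cylinder]
    rw [this, Set.inter_univ]
  | insert e T he ih =>
    rw [cylinder_insert, ← Set.inter_assoc, Set.inter_right_comm,
      ih (fun f hf => hT f (Finset.mem_insert_of_mem hf)) _]
    have hpe := hT e (Finset.mem_insert_self e T)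
    cases hσ : σ e
    · rw [hσ] at hpe
      simp only [Bool.false_eq_true, if_false] at hpe ⊢
      rw [prob_inter_closedEdge, hpe, sub_zero, one_mul, ← hpe, Function.update_eq_self]
    · rw [hσ] at hpe
      simp only [if_true] at hpe ⊢
      rw [prob_inter_openEdge, hpe, one_mul, ← hpe, Function.update_eq_self]

/-- The background cylinder is forced by the weights. -/
lemma prob_inter_back (B : Broom ends s t u v) (a b d : ℝ) (A : Set (Config E)) :
    prob (B.wt a b d) (A ∩ B.back) = prob (B.wt a b d) A :=
  prob_inter_cylinder_of_forced _ _ _ (fun e he => by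
    simp only [Finset.mem_sdiff, Finset.mem_univ, true_and, Finset.mem_insert,
      Finset.mem_singleton, not_or] at he
    exact B.wt_of_ne a b d he.1 he.2.1 he.2.2) A

/-- The probability of a single local configuration. -/
lemma prob_cylinder_univ_loc (B : Broom ends s t u v) (a b d : ℝ) (x : Bool × Bool × Bool) :
    prob (B.wt a b d) (cylinder Finset.univ (B.loc x)) =
      edgeFactor a x.1 * edgeFactor b x.2.1 * edgeFactor d x.2.2 := by
  rw [prob_cylinder]
  have hsub : ({B.fs, B.g, B.ft} : Finset E) ⊆ Finset.univ := Finset.subset_univ _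
  rw [← Finset.prod_sdiff hsub]
  have h1 : ∏ e ∈ (Finset.univ \ {B.fs, B.g, B.ft}),
      edgeFactor (B.wt a b d e) (B.loc x e) = 1 := by
    apply Finset.prod_eq_one
    intro e he
    simp only [Finset.mem_sdiff, Finset.mem_univ, true_and, Finset.mem_insert,
      Finset.mem_singleton, not_or] at he
    rw [B.wt_of_ne a b d he.1 he.2.1 he.2.2, B.loc_of_ne x he.1 he.2.1 he.2.2]
    cases B.ω₁ e <;> simp [edgeFactor]
  rw [h1, one_mul, Finset.prod_insert, Finset.prod_insert, Finset.prod_singleton]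
  · rw [B.wt_fs, B.wt_g, B.wt_ft, B.loc_fs, B.loc_g, B.loc_ft]
    ring
  · simp [B.ft_ne_g.symm]
  · simp [B.fs_ne_g, B.fs_ne_ft]

end FinE

section Full

variable [Fintype V] [DecidableEq V] [Fintype E]

/-- A grid event on the background is a single local configuration. -/
lemma gridEvent_inter_back_eq (B : Broom ends s t u v) (k : Fin 3 × Fin 3) (x : Bool × Bool × Bool)
    (h : ∀ ω, B.Agrees ω → (ω ∈ PairTP2.gridEvent ends s t u v k ↔
      ω B.fs = x.1 ∧ ω B.g = x.2.1 ∧ ω B.ft = x.2.2)) :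
    PairTP2.gridEvent ends s t u v k ∩ B.back = cylinder Finset.univ (B.loc x) := by
  ext ω
  simp only [Set.mem_inter_iff, mem_cylinder, Finset.mem_univ, true_implies]
  constructor
  · rintro ⟨hg, hb⟩
    rw [B.mem_back] at hb
    obtain ⟨h1, h2, h3⟩ := (h ω hb).1 hg
    intro e
    have := congrFun (B.eq_loc hb) e
    rw [this, h1, h2, h3]
  · intro hω'
    have hω : ω = B.loc x := funext hω'
    have hA : B.Agrees ω := by
      rw [hω]
      exact B.agrees_loc x
    refine ⟨(h ω hA).2 ⟨?_, ?_, ?_⟩, B.mem_back.2 hA⟩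
    · rw [hω, B.loc_fs]
    · rw [hω, B.loc_g]
    · rw [hω, B.loc_ft]

/-- `M(S, T) = a (1 − b) d`. -/
lemma mass_ST (B : Broom ends s t u v) (a b d : ℝ) :
    BoxUnionPair.pairLaw (B.wt a b d) ends {u, v} s t (PairTP2.iota u v (2, 0)) =
      a * (1 - b) * d := by
  rw [PairTP2.mass_eq ends s t B.u_ne_v 2 0, ← B.prob_inter_back,
    B.gridEvent_inter_back_eq (2, 0) (true, false, true) (fun ω hA => B.mem_gridEvent_ST hA),
    B.prob_cylinder_univ_loc]
  simp [edgeFactor]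

/-- `M(N, T) = (1 − a)(1 − b) d`. -/
lemma mass_NT (B : Broom ends s t u v) (a b d : ℝ) :
    BoxUnionPair.pairLaw (B.wt a b d) ends {u, v} s t (PairTP2.iota u v (1, 0)) =
      (1 - a) * (1 - b) * d := by
  rw [PairTP2.mass_eq ends s t B.u_ne_v 1 0, ← B.prob_inter_back,
    B.gridEvent_inter_back_eq (1, 0) (false, false, true) (fun ω hA => B.mem_gridEvent_NT hA),
    B.prob_cylinder_univ_loc]
  simp [edgeFactor]

/-- `M(S, N) = a (1 − b)(1 − d)`. -/
lemma mass_SN (B : Broom ends s t u v) (a b d : ℝ) :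
    BoxUnionPair.pairLaw (B.wt a b d) ends {u, v} s t (PairTP2.iota u v (2, 1)) =
      a * (1 - b) * (1 - d) := by
  rw [PairTP2.mass_eq ends s t B.u_ne_v 2 1, ← B.prob_inter_back,
    B.gridEvent_inter_back_eq (2, 1) (true, false, false) (fun ω hA => B.mem_gridEvent_SN hA),
    B.prob_cylinder_univ_loc]
  simp [edgeFactor]

/-- `M(N, N) = (1 − a)(1 − d)`: the interface edge is free. -/
lemma mass_NN (B : Broom ends s t u v) (a b d : ℝ) :
    BoxUnionPair.pairLaw (B.wt a b d) ends {u, v} s t (PairTP2.iota u v (1, 1)) =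
      (1 - a) * (1 - d) := by
  rw [PairTP2.mass_eq ends s t B.u_ne_v 1 1, ← B.prob_inter_back]
  have hsplit : PairTP2.gridEvent ends s t u v (1, 1) ∩ B.back =
      cylinder Finset.univ (B.loc (false, false, false)) ∪
        cylinder Finset.univ (B.loc (false, true, false)) := by
    ext ω
    simp only [Set.mem_inter_iff, Set.mem_union, mem_cylinder, Finset.mem_univ, true_implies]
    constructor
    · rintro ⟨hg, hb⟩
      rw [B.mem_back] at hb
      obtain ⟨h1, h3⟩ := (B.mem_gridEvent_NN hb).1 hg
      have hω := congrFun (B.eq_loc hb)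
      cases h2 : ω B.g
      · left
        intro e
        rw [hω e, h1, h2, h3]
      · right
        intro e
        rw [hω e, h1, h2, h3]
    · intro hω'
      have key : ∀ x : Bool × Bool × Bool, x.1 = false → x.2.2 = false → ω = B.loc x →
          ω ∈ PairTP2.gridEvent ends s t u v (1, 1) ∧ ω ∈ B.back := by
        intro x hx1 hx3 hω
        have hA : B.Agrees ω := by
          rw [hω]
          exact B.agrees_loc x
        refine ⟨(B.mem_gridEvent_NN hA).2 ⟨?_, ?_⟩, B.mem_back.2 hA⟩
        · rw [hω, B.loc_fs, hx1]
        · rw [hω, B.loc_ft, hx3]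
      rcases hω' with hω' | hω'
      · exact key _ rfl rfl (funext hω')
      · exact key _ rfl rfl (funext hω')
  have hdisj : Disjoint (cylinder Finset.univ (B.loc (false, false, false)))
      (cylinder Finset.univ (B.loc (false, true, false))) := by
    rw [Set.disjoint_left]
    intro ω h1 h2
    have e1 := h1 B.g (Finset.mem_univ _)
    have e2 := h2 B.g (Finset.mem_univ _)
    rw [B.loc_g] at e1 e2
    rw [e1] at e2
    exact Bool.false_ne_true e2
  rw [hsplit, prob_union_of_disjoint _ hdisj, B.prob_cylinder_univ_loc, B.prob_cylinder_univ_loc]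
  simp only [edgeFactor_true, edgeFactor_false]
  ring

/-- **The broom violates log-supermodularity** at every `a, b, d ∈ (0, 1)`: the pair
`(S, T), (N, N)` fails the lattice condition for the two-vertex status law. -/
theorem not_lsm (B : Broom ends s t u v) {a b d : ℝ} (ha : 0 < a ∧ a < 1) (hb : 0 < b ∧ b < 1)
    (hd : 0 < d ∧ d < 1) :
    ¬ ∀ x y : BoxUnionPair.ZLat V,
      BoxUnionPair.pairLaw (B.wt a b d) ends {u, v} s t x *
          BoxUnionPair.pairLaw (B.wt a b d) ends {u, v} s t y ≤
        BoxUnionPair.pairLaw (B.wt a b d) ends {u, v} s t (x ⊓ y) *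
          BoxUnionPair.pairLaw (B.wt a b d) ends {u, v} s t (x ⊔ y) := by
  intro h
  have h' := h (PairTP2.iota u v (2, 0)) (PairTP2.iota u v (1, 1))
  rw [← PairTP2.iota_inf B.u_ne_v, ← PairTP2.iota_sup B.u_ne_v] at h'
  have hinf : ((2 : Fin 3), (0 : Fin 3)) ⊓ ((1 : Fin 3), (1 : Fin 3)) = (1, 0) := by decide
  have hsup : ((2 : Fin 3), (0 : Fin 3)) ⊔ ((1 : Fin 3), (1 : Fin 3)) = (2, 1) := by decide
  rw [hinf, hsup, B.mass_ST, B.mass_NN, B.mass_NT, B.mass_SN] at h'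
  have key : a * (1 - b) * d * ((1 - a) * (1 - d)) -
      (1 - a) * (1 - b) * d * (a * (1 - b) * (1 - d)) =
        a * b * d * ((1 - a) * (1 - b) * (1 - d)) := by ring
  have hpos : 0 < a * b * d * ((1 - a) * (1 - b) * (1 - d)) :=
    mul_pos (mul_pos (mul_pos ha.1 hb.1) hd.1)
      (mul_pos (mul_pos (by linarith) (by linarith)) (by linarith))
  linarith

end Full

end Broom

end PairTP2Broom

end Summit.Ventures.PercRepro2
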